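import Summits.CriticalPhenomena.Ising3DConformalLimit.Theorems.EnergyNotSigmaSquaredMoebiusLimitExistsLocallyBounded
import HarnessLib

/-!
# Pair bounds give local bounds at every order (Newman's Gaussian inequality), without the two-point law
(stub F1 `stub_locallyBounded_of_pairBound` of line `Sketch`, crux `ExistsScaleCovariantLimit`,
item stmt-CriticalPhenomena-1981, route `HyperoctahedralRP`; lead c4, 2026-08-16)

If along every mesh sequence `u k → 0⁺` the pinned PAIR zoom `ρ_pin(u k)²⟨σ_{[x₀/u k]}σ_{[x₁/u k]}⟩_{β_c}` is eventually
bounded on every compact set of non-coincident pairs, then the pinned zoom of EVERY order `n` is eventually bounded on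
every compact `K ⊆ NonCoincident 3 n`: odd orders vanish (`criticalCorr_eq_zero_of_odd`); at even order `2m`,
`0 ≤ ⟨∏σ⟩ ≤ 𝒢_m[⟨σσ⟩]` (Griffiths I `criticalCorr_nonneg'`, Newman's Gaussian inequality `criticalCorr_le_pairingSum`), the
rescaled pairing functional is the pairing functional of the pinned pair zooms (`PairIsing.pairingSum_eq_pow_mul`) at the
compact pair-sets `{(xᵢ, xⱼ) : x ∈ K}`, each eventually bounded BY HYPOTHESIS, whence the bound `(2m)! B₂ᵐ`
(`pairingSum_le_factorial_mul_pow`). This is the proof of crux 1344's `pinnedZoomLocallyBounded`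
(`…MoebiusLimitExistsLocallyBounded.lean`) with its single use of the two-point law
(`exists_eventually_rescaledCorrelator_two_le`) replaced by the hypothesis; with F2/F3 of the line it shows that item 5955
`OrbitPrecompact` follows from uniform regularity of the pair zoom alone.
-- adapted from Theorems/EnergyNotSigmaSquaredMoebiusLimitExistsLocallyBounded.lean (line only-interaction-breaks-moebius).

References: C. M. Newman, Z. Wahrsch. 33 (1975) [Newman1975Gaussian]; M. Aizenman, H. Duminil-Copin, Ann. Math. 194
(2021) §6.3 [AizenmanDuminilCopinAnnals2021]. No definitions, no `sorry`.
-/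

noncomputable section

namespace Summit.CriticalPhenomena.Ising3DConformalLimit.Cruxes.ExistsScaleCovariantLimit.TwoHierarchies

open Literature.Probability.LatticeModels Filter Set Function
open scoped Topology
open Summit.CriticalPhenomena.Ising3DConformalLimit.MoebiusLimitExistsOnlyInteraction

/-- **F1 (registered stub of line `Sketch`) — PAIR BOUNDS GIVE LOCAL BOUNDS AT EVERY ORDER.** If along every mesh
sequence `u k → 0⁺` the pinned pair zoom is eventually bounded on every compact set of non-coincident pairs, then so is
the pinned zoom of every order on every compact set of non-coincident configurations (odd orders: `0`; even order `2m`: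
Griffiths I and Newman's Gaussian inequality reduce to the pair zooms at the compact pair-sets `{(xᵢ, xⱼ) : x ∈ K}`,
bound `(2m)! B₂ᵐ`). [cite: AizenmanDuminilCopinAnnals2021, arXiv:1912.07973 §6.3, first display, lower inequality (p. 26)] -/
theorem stub_locallyBounded_of_pairBound :
    (∀ u : ℕ → ℝ, Tendsto u atTop (𝓝[>] (0 : ℝ)) →
      ∀ K : Set (Fin 2 → EuclideanSpace ℝ (Fin 3)), IsCompact K → K ⊆ NonCoincident 3 2 →
        ∃ M : ℝ, ∀ᶠ k in atTop, ∀ x ∈ K, |rescaledCorrelator (criticalCorr 3) rhoPin 2 (u k) x| ≤ M) →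
    ∀ u : ℕ → ℝ, Tendsto u atTop (𝓝[>] (0 : ℝ)) →
      ∀ (n : ℕ) (K : Set (Fin n → EuclideanSpace ℝ (Fin 3))), IsCompact K → K ⊆ NonCoincident 3 n →
        ∃ M : ℝ, ∀ᶠ k in atTop, ∀ x ∈ K, |rescaledCorrelator (criticalCorr 3) rhoPin n (u k) x| ≤ M := by
  -- adapted from …MoebiusLimitExistsLocallyBounded.lean `pinnedZoomLocallyBounded` (line only-interaction-breaks-moebius)
  intro hPB u hu n K hK hKs
  rcases Nat.even_or_odd n with hn | hn
  swap
  · -- odd orders vanish identically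
    refine ⟨0, Eventually.of_forall fun k x _ => ?_⟩
    rw [rescaledCorrelator_apply, criticalCorr_eq_zero_of_odd (d := 3) le_rfl hn, mul_zero, abs_zero]
  obtain ⟨m, hm⟩ := hn
  rw [← two_mul] at hm
  subst hm
  -- the rescaled pair kernel at the level of indices (diagonal zeroed), as an opaque function
  obtain ⟨T, hT⟩ : ∃ T : ℕ → (Fin (2 * m) → EuclideanSpace ℝ (Fin 3)) → Fin (2 * m) → Fin (2 * m) → ℝ,
      ∀ k x i j, T k x i j = if i = j then 0 else
        rhoPin (u k) ^ 2 * criticalCorr 3 2 ![latticeApprox (u k) (x i), latticeApprox (u k) (x j)] :=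
    ⟨fun k x i j => if i = j then 0 else
        rhoPin (u k) ^ 2 * criticalCorr 3 2 ![latticeApprox (u k) (x i), latticeApprox (u k) (x j)],
      fun _ _ _ _ => rfl⟩
  have hTeq : ∀ k x i j, i ≠ j →
      T k x i j = rescaledCorrelator (criticalCorr 3) rhoPin 2 (u k) ![x i, x j] := by
    intro k x i j hij
    rw [hT, if_neg hij, rescaledCorrelator_apply, latticeApprox_comp_two]
    rfl
  have hT0 : ∀ k x i j, 0 ≤ T k x i j := by
    intro k x i j
    rw [hT]
    split_ifs
    · exact le_rfl
    · exact mul_nonneg (sq_nonneg _) (criticalCorr_two_nonneg _ _)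
  -- eventual bounds for each entry, from the HYPOTHESIS on the compact pair-sets `{(xᵢ, xⱼ) : x ∈ K}`
  have hpair : ∀ ij : Fin (2 * m) × Fin (2 * m), ∃ B : ℝ, ∀ᶠ k in atTop, ∀ x ∈ K,
      T k x ij.1 ij.2 ≤ B := by
    rintro ⟨i, j⟩
    show ∃ B : ℝ, ∀ᶠ k in atTop, ∀ x ∈ K, T k x i j ≤ B
    by_cases hij : i = j
    · refine ⟨0, Eventually.of_forall fun k x _ => ?_⟩
      rw [hT, if_pos hij]
    · have hcont : Continuous fun x : Fin (2 * m) → EuclideanSpace ℝ (Fin 3) =>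
          (![x i, x j] : Fin 2 → EuclideanSpace ℝ (Fin 3)) :=
        (continuous_apply i).matrixVecCons ((continuous_apply j).matrixVecCons continuous_const)
      have hPc : IsCompact ((fun x : Fin (2 * m) → EuclideanSpace ℝ (Fin 3) =>
          (![x i, x j] : Fin 2 → EuclideanSpace ℝ (Fin 3))) '' K) := hK.image hcont
      have hPs : (fun x : Fin (2 * m) → EuclideanSpace ℝ (Fin 3) =>
          (![x i, x j] : Fin 2 → EuclideanSpace ℝ (Fin 3))) '' K ⊆ NonCoincident 3 2 := by
        rintro _ ⟨x, hx, rfl⟩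
        exact pair_mem_nonCoincident fun h => hij ((mem_nonCoincident x).1 (hKs hx) h)
      obtain ⟨B, hB⟩ := hPB u hu _ hPc hPs
      refine ⟨B, hB.mono fun k hk x hx => ?_⟩
      rw [hTeq k x i j hij]
      exact (le_abs_self _).trans (hk _ (Set.mem_image_of_mem _ hx))
  choose B hB using hpair
  obtain ⟨B₂, hBle⟩ : ∃ B₂ : ℝ, ∀ ij, B ij ≤ B₂ :=
    ⟨∑ ij, max (B ij) 0, fun ij => (le_max_left _ _).trans (Finset.single_le_sum
      (f := fun ij => max (B ij) 0) (fun ij _ => le_max_right _ _) (Finset.mem_univ ij))⟩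
  have hall : ∀ᶠ k in atTop, ∀ ij : Fin (2 * m) × Fin (2 * m), ∀ x ∈ K, T k x ij.1 ij.2 ≤ B ij :=
    eventually_all.2 hB
  refine ⟨(2 * m).factorial * B₂ ^ m, ?_⟩
  filter_upwards [hall] with k hk x hx
  have hTB : ∀ i j, T k x i j ≤ B₂ := fun i j => (hk (i, j) x hx).trans (hBle (i, j))
  -- index-level rescaling identity
  have hP : pairingSum (T k x) m id = (rhoPin (u k) ^ 2) ^ m *
      pairingSum (fun a b => criticalCorr 3 2 ![a, b]) m (fun i => latticeApprox (u k) (x i)) :=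
    PairIsing.pairingSum_eq_pow_mul (fun a b => criticalCorr 3 2 ![a, b]) (T k x) (rhoPin (u k) ^ 2) m
      (fun i => latticeApprox (u k) (x i)) id fun i j hij => by
        simp only [hT, id_eq, if_neg hij]
  have hF : rescaledCorrelator (criticalCorr 3) rhoPin (2 * m) (u k) x =
      (rhoPin (u k) ^ 2) ^ m * criticalCorr 3 (2 * m) (fun i => latticeApprox (u k) (x i)) := by
    rw [rescaledCorrelator_apply, pow_mul]
  have hρ : 0 ≤ (rhoPin (u k) ^ 2) ^ m := pow_nonneg (sq_nonneg _) m
  have hnn : 0 ≤ criticalCorr 3 (2 * m) (fun i => latticeApprox (u k) (x i)) :=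
    Theorems.GapForcesFarMerging.Negative.criticalCorr_nonneg' _
  rw [hF, abs_of_nonneg (mul_nonneg hρ hnn)]
  calc (rhoPin (u k) ^ 2) ^ m * criticalCorr 3 (2 * m) (fun i => latticeApprox (u k) (x i))
      ≤ (rhoPin (u k) ^ 2) ^ m *
          pairingSum (fun a b => criticalCorr 3 2 ![a, b]) m (fun i => latticeApprox (u k) (x i)) :=
        mul_le_mul_of_nonneg_left (criticalCorr_le_pairingSum m _) hρ
    _ = pairingSum (T k x) m id := hP.symm
    _ ≤ (2 * m).factorial * B₂ ^ m := pairingSum_le_factorial_mul_pow (hT0 k x) hTB m id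

end Summit.CriticalPhenomena.Ising3DConformalLimit.Cruxes.ExistsScaleCovariantLimit.TwoHierarchies

end
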